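import Mathlib.Tactic
import HarnessLib

/-!
# Venture HSemireg — the LATIN-SQUARE CERTIFICATE of THEOREM H (LEMMA H″)

Third companion to `FibrePartition.lean` (THEOREM F), `WeightedFibreCounterexample.lean` (H⁻) and
`AdditiveClassDeath.lean` (THEOREM H, pad-pair form): the EIGHTEEN-LINE certificate by which the
exact eliminations of seat p2 gen 13 (`p2/wlaws/WEIGHTED-LOCAL-p2g13.md` §9f, LEMMA H″; kit
j232589 ∕ j232921 on the THEOREM-F-clean skeletons j211074 it1 ∕ it2) prove «additive ⇒ class-dead».
On such a support, a sloped line `L` of one slot together with the two triangles `ℓ₀,ℓ₁,ℓ₂` and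
`m₀,m₁,m₂` of the other slots (one line per slope) and two AXIS lines `H ∋ p_i ∈ ℓ_i`, `H′ ∋ r_j ∈ m_j`
gives nine pad-pair curves `p_i × L × r_j` whose stars are {pad `N_i`, pad `B_j`, Weil triple
`W_ij = (ℓ_i, L, m_j)`, the common axis partner `R = (H, L, H′)`}; the Weil class of `W_ij` is
`i + j + s(L) (mod 3)`, a LATIN pattern.  Additivity at the nine curves, `N_i + B_j = W_ij + R`, forces
the three «generalized diagonal» sums `∑_{i+j+s = k} W_ij` to be equal (each is `∑ N + ∑ B − 3R`), so
the classes are balanced with weights on this square; if every triangle line `L` of the slot has such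
a square, the weighting is class-dead (note §9f).  THIS FILE checks the square step abstractly:
`latin_diagonal_sums_eq`.  Which supports carry covering families of such squares is a machine
statement about the designs (kit j233242), not part of the kernel.

HONEST FRAMING. A nine-term bookkeeping identity over `ZMod 3 × ZMod 3` (slope classes mod 3); no variety, cycle, cohomology
class or semiregularity map occurs; nothing here bears on HC ∕ HC_CM ∕ HC_AV.
-/

namespace Summit.Ventures.HSemireg
namespace LatinSquareCertificate

open Finset

/-- **LEMMA H″ (Latin-square certificate), kernel form.** Weights `W i j` on a 3 × 3 square of Weil
triples with classes `i + j + s`, pad weights `N i`, `B j`, a common partner weight `R`, additivity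
`N i + B j = W i j + R` at all nine curves ⇒ the weighted class sums over the square agree for any two
classes `k₁`, `k₂`. -/
theorem latin_diagonal_sums_eq (W : ZMod 3 → ZMod 3 → ℤ) (N B : ZMod 3 → ℤ) (R : ℤ) (s : ZMod 3)
    (hadd : ∀ i j, N i + B j = W i j + R) (k₁ k₂ : ZMod 3) :
    ∑ i, ∑ j ∈ univ.filter (fun j => i + j + s = k₁), W i j
      = ∑ i, ∑ j ∈ univ.filter (fun j => i + j + s = k₂), W i j := by
  -- the class-k cells form the generalized diagonal j = k - s - i
  have hcell : ∀ k i : ZMod 3, univ.filter (fun j : ZMod 3 => i + j + s = k) = {k - s - i} := by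
    intro k i
    ext j
    rw [mem_filter, mem_singleton]
    constructor
    · rintro ⟨-, h⟩; rw [← h]; ring
    · intro h; exact ⟨mem_univ _, by rw [h]; ring⟩
  -- each diagonal sum equals ∑ N + ∑ B − 3R
  have key : ∀ k : ZMod 3, ∑ i, ∑ j ∈ univ.filter (fun j => i + j + s = k), W i j
      = ∑ i, (N i + B (k - s - i) - R) := by
    intro k
    refine sum_congr rfl fun i _ => ?_
    rw [hcell k i, sum_singleton]
    have := hadd i (k - s - i)
    omega
  -- ∑_i B (k - s - i) does not depend on k: reindex by the bijection i ↦ (k - s) - i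
  have hB : ∀ k : ZMod 3, ∑ i, B (k - s - i) = ∑ j, B j := fun k =>
    Fintype.sum_equiv (Equiv.subLeft (k - s)) _ _ (fun i => rfl)
  rw [key k₁, key k₂]
  simp only [sum_sub_distrib, sum_add_distrib, hB]

end LatinSquareCertificate
end Summit.Ventures.HSemireg
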